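import Summits.BirchSwinnertonDyer.Rank1Residual.X11b.JetchevIndexRecordsKit
import HarnessLib

/-!
# BSD rank-≤1 residual cell, lane class X11b (`p ∥ N`: MULTIPLICATIVE at a prime `p ≥ 5`, `ρ̄_{E,p}` onto), rank ONE,
# Tamagawa-OBSTRUCTED with ONE Tamagawa prime: `BSD(E,p)` PER PAIR from Miller 2011 Thm. 5.4 (Cha case; FLAGGED) + GZK +
# a two-engine Jetchev HEEGNER-INDEX certificate in a DEEP field, the Tamagawa half and `E[p]` irreducible IN THE KERNEL — records 09

HONEST FRAMING (cell `b2b-bsdres-*`, verbatim): prove what is provable now; shrink each hard class to its core with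
data; no claim beyond stated classes; COMBINATION classes deleted from PUBLISHED theorems only, CONSTRUCTION-shaped
remainder typed; this is not "finishing BSD". X11b stays CONSTRUCTION-SHAPED; everything here is PER PAIR; no lane
verdict is changed; no named fact is introduced (debt 0: `hMJ`, `hGZK` are the tree's existing published named facts,
`hMJ` = Miller 2011 Thm. 5.4 in the Cha case carries the registry FLAGS `Miller11-Thm54-Cha-case` and `JET@p|N` —
these records are LITERAL currency, flag-free only the day director-bsd's ITEM (J∥) lands); nothing is booked by this
unit (census-lead, the Kurihara lane, the x11b lineage, bsd-jet and referee A decide what a record is worth); Cremona's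
numbers (`r_an = 1`, `#Ш_an`, models, generators, `∏ c_ℓ`, torsion, optimality / Manin codes, the galrep datum) and
the lane's per-prime `bad` tables are INPUTS.

Unit `b2b-bsdres-x11c`, GEN 33 (prover-b2b-bsdres-x11c-g33-0), move «JDEEP». POPULATION (`HOME/b2b-bsdres-x11c/gen33/jdeep/pop/`:
gen 32's class census `harvest_x11b_all.json` restricted to shape `tamobs` × this gen's zero-compute J-shape census of the
lane's own per-prime tables): of the 3 062 rank-ONE X11b cells at `p ≥ 5` that are OPEN on the Kurihara lane's residue of
record (bsdN sweep v4u/v5u) with `ρ̄_{E,p}` onto, `p ∤ #E(ℚ)_tors`, `p ∤ #Ш_an` but `p ∣ ∏ c_ℓ` (outside the Kolyvagin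
road of GEN 32's `KolyvaginIndexRecordsX11bRankOne01–95`), exactly **98 are «J1»: ONE prime `q ∣ N` with `p ∣ c_q`**
(always split multiplicative `Iₙ`, `w := ord_p c_q = ord_p n`; 82 @5, 15 @7, 1 @13; `q = p` itself for 27), 2 901 are J2
and 63 J3 (two / three such primes). For a J1 cell the Jetchev MAX-form bound `ord_p #Ш(E/ℚ) ≤ 2(ord_p [E(K):ℤy_K] −
max_q ord_p c_q)` reaches `0` in a Heegner field `K` with `ord_p [E(K):ℤy_K] = w` (Gross–Zagier + BSD over `K` predict
`ord_p [E(K):ℤy_K] = Σ_q ord_p c_q + ½ ord_p #Ш(E/K)`); the lane's fields of record (`|D| ≤ 1511`) read `w + 1` on every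
one of these 98 cells (the J1 cells with a `w`-field were booked T-JET literal and left the residue), so this gen ran the
cell's engine 1 DEEPER (VERBATIM, `NDISC 16` / `DBOUND 6000`) and found a `w`-field for the rows below; engine 2
(VERBATIM stdlib re-implementation) recomputes `m` EQUAL; the twist side (`E^D`: `#Ш_an`, `∏c`, torsion) is printed per
row (BSD-consistency: `ord_p #Ш_an(E^D) = 0`, `ord_p ∏c(E^D) = w`); the Tamagawa prime has THREE engines (A = Tate's
algorithm `tateY`, B = PARI `elllocalred`, C = the rank-2 observatory's certificate engine whose `TamLocal` certificate the
KERNEL re-checks). Kit jobs: engine 1 j268106 (14 c, 54 min), very deep j269293 (460020m1); engine 2 + twist values + Tamagawa engine B j269294 (8 c, 50 min); PARI third check j270395. Each record `bsdp_j<label>_<p>` is ONE application of the GEN 33 kit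
`X11b.bsdp_prime_of_jetchevIndex_of_tamLocal[_support]` (p496494; = the unit's gen-4 route
`bsdp_of_ainvs_of_jetchevChaCertificate` + kernel minimality + kernel irreducibility + n1011's kernel `c_q` transport) with
`decide` goals; binders displayed: `hMJ` (FLAGGED), `hGZK`, the Heegner datum (`K`, `p ∤ d_K`, `p² ∤ N`, `P = y_K` of
infinite order), `q ∣ N`, the index line `hv : ord_p [E(K):ℤP] ≤ w`, `r_an ≤ 1`, `#Ш_an` a `p`-adic unit. Currency:
LITERAL (the lane's T-JET row with flag `JET@p|N`; bucket-B-shaped for bsd-jet); every one of the 98 cells ALSO carries the unit's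
GEN 10 beyond-window DATA record (`X11b/BeyondWindowRecordsNN` ×95 / `BeyondWindowSurjRecordsNN` ×3, Skinner 2016 Thm. A /
Kato–Wuthrich road, binders as displayed there) — these records are a SECOND road for them. Table `HOME/b2b-bsdres-x11c/gen33/jdeep/JDEEP-TABLE.md`; population `jdeep/pop/JDEEP-POP.md`; J-shape census
`jdeep/pop/census_jpar.json`. Pairs in this file: `108570bn1`@7, `155610bd1`@7, `170170v1`@7, `270270y1`@7, `303450fd1`@7, `306306ch1`@7, `312018by1`@7, `395010co1`@7, `408870cx1`@7, `428400bx1`@7.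

References: R. L. Miller, LMS J. Comput. Math. 14 (2011) Thm. 5.4, Thm. 5.2, Thm. 4.1, Cor. 4.8, Def. 1.1 [Miller2011LMS];
D. Jetchev, Compos. Math. 144 (2008) Thm. 1.1 [Jetchev2008]; B. H. Gross, D. Zagier, Invent. Math. 84 (1986) I (6.5)
[GrossZagier1986]; B. Mazur, Invent. Math. 44 (1978) Prop. 6.3 (1) [Mazur1978]; J. Tate, LNM 476 (1975) §7 [Tate1975];
J. H. Silverman, GTM 151 (1994) IV.9.4 [Silverman1994]; J. H. Silverman, *AEC* (2009) VII.1 Rem. 1.1, VII.6 Ex. 7.6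
[SilvermanAEC2009]; A. Kraus, Acta Arith. 54 (1989) [Kraus1989]; J. E. Cremona, *Algorithms for Modular Elliptic Curves*
(1997) §3.2, Table 1 [CremonaAlgorithms1997]; Cremona's tables [Cremona2006].
-/

set_option autoImplicit false

noncomputable section

open scoped Classical

open WeierstrassCurve Literature.NumberTheory.EllipticCurves
  Literature.NumberTheory.EllipticCurves.Rank1Residual
  Literature.NumberTheory.EllipticCurves.Rank1Residual.Typed
  Literature.NumberTheory.EllipticCurves.Miller2011
  Literature.NumberTheory.EllipticCurves.Rank1Residual.X11RankOneCertificates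
  Summit.BirchSwinnertonDyer.BirchSwinnertonDyer.Rank1Residual.IntModel
  Summit.BirchSwinnertonDyer.BirchSwinnertonDyer.Rank1Residual.X11RankOne
  Summit.BirchSwinnertonDyer.BirchSwinnertonDyer.Rank2Observatory.Tam
  Summit.BirchSwinnertonDyer.Rank1Residual.Additive

namespace Summit.BirchSwinnertonDyer.Rank1Residual.X11b

/-- **`BSD(E,7)` for `108570bn1`** (`N = 108570 = 2·3·5·7·11·47`; NON-SPLIT MULTIPLICATIVE at `7` (Kodaira `I5`, `c_7 = 1`); `#tors = 1`, `∏c = 35`,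
`r_an = 1`, `#Ш_an = 1`, `ρ̄_{E,7}` onto (Cremona galrep: no code); lane residue cell `(7, X11b)` (bsdN v4u/v5u of record: `residue:X11b`);
ALSO the unit's GEN 10 beyond-window DATA record in `X11b/BeyondWindowRecords12.lean` (binders as displayed there)). Tamagawa-OBSTRUCTED, shape J1: the ONLY prime `q ∣ N` with `7 ∣ c_q` is `q = 2` (Kodaira `I7` split, `c_2 = 7`, `w = ord_7 c_2 = 1`) — engines A (Tate `tateY`) = B (PARI
`elllocalred`, j269294) = C (observatory `TamLocal` ⟨2, 1, 1, 0, 0, 0, 0, 7, 0, 0, 7⟩, re-checked by the kernel below). Lane fields of record (`|D| ≤ 1511`): `-1151`: `m = 490` (`ord = 2`).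
DEEP FIELD `D = -2999` (prime): **`m = [E(K):ℤy_K] = 770`, `ord_7 m = 1 = w`** (`ρ = 148225`; `L'(E,1) = 6.935333563`, `L(E^D,1) = 2.877232034`, `ĥ(x) = 7.266553317`; `N_{E^D} = 976478688570`)
— engine 1 (j268106) = engine 2 (j269294): `m = 770` EQUAL, dev. ≤ 4.6e-14, checks true; twist `E^D` (j269294): `N_F = 976478688570`, `#tors·∏c·#Ш_an = 1·35·121` — `ord_7 #Ш_an(E^D) = 0`, `ord_7 ∏c(E^D) = 1` — BSD-consistent. Jetchev MAX-form: `ord_7 #Ш(E/ℚ) ≤ 2(w − w) = 0 = ord_7 #Ш_an` ⇒ Miller's `BSD(E,7)` modulo the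
displayed binders (`hMJ` FLAGGED `Miller11-Thm54-Cha-case`, `JET@p|N`; `hGZK`; Heegner datum; `hv`; `hr`; `hs`). Kernel: `Δ ≠ 0`,
global minimality (bounded Kraus criterion), `7 ∣ Δ ∧ 7 ∤ c₄`, `E[7]` irreducible (`ℓ = 19`, `#Ẽ(𝔽_19) = 15`, `a_19 = 5`, `X² − a_ℓX + ℓ` root-free
mod `7`), `c_2(W/ℚ_2) = 7` (`TamLocal` ⟨2, 1, 1, 0, 0, 0, 0, 7, 0, 0, 7⟩). Per pair; LITERAL currency; nothing booked.
[cite: Miller2011LMS, Thm. 5.4 (arXiv:1010.2431 p. 11) and Def. 1.1] [cite: Jetchev2008, Thm. 1.1] [cite: Mazur1978, §6 Prop. 6.3 (1) (p. 153)]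
[cite: Silverman1994, IV.9.4] [cite: Cremona2006, Table 1 (label 108570bn1)] -/
theorem bsdp_j108570bn1_7 (hMJ : thm54_cha_padicValNat_shaOrder_add_tamagawa_le)
    (hGZK : rank_eq_analyticRank_of_analyticRank_le_one) (W : WeierstrassCurve ℚ)
    (hW : W = ⟨1, 1, 1, -982273656, -10021433574087⟩) {N : ℕ} [NeZero N] {K : Type} [Field K] [NumberField K]
    (hK : IsImaginaryQuadratic K) (hH : SatisfiesHeegnerHypothesis N K) {P : (W.baseChange K).toAffine.Point}
    (hP : IsHeegnerPoint N W K P) (hnt : ¬ IsOfFinAddOrder P) (hpD : ¬ (7 : ℤ) ∣ NumberField.discr K)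
    (hpN : ¬ 7 ^ 2 ∣ N) (hqN : 2 ∣ N) (hv : padicValNat 7 (AddSubgroup.zmultiples P).index ≤ 1)
    (hr : W.analyticRank ≤ 1) {s : ℚ} (hs : shaAn W = (s : ℂ)) (hvs : padicValRat 7 s = 0) : BSDp W 7 :=
  bsdp_prime_of_jetchevIndex_of_tamLocal 7 (by norm_num) (by norm_num) 1 1 1 (-982273656) (-10021433574087) (by decide +kernel)
    (by decide +kernel) (by decide +kernel) (by decide +kernel) (by decide +kernel) 19 (by norm_num) (by norm_num) (by norm_num)
    (by decide +kernel) (n := 15) (by decide +kernel) (by decide +kernel) 2 (by norm_num) (T := ⟨2, 1, 1, 0, 0, 0, 0, 7, 0, 0, 7⟩) rfl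
    (by decide +kernel) (c := 7) (by decide +kernel) (w := 1) (by decide +kernel) hMJ hGZK W hW hK hH hP hnt (mod_cast hpD)
    hpN hqN hv hr hs hvs

/-- **`BSD(E,7)` for `155610bd1`** (`N = 155610 = 2·3²·5·7·13·19`; NON-SPLIT MULTIPLICATIVE at `7` (Kodaira `I2`, `c_7 = 2`); `#tors = 1`, `∏c = 504`,
`r_an = 1`, `#Ш_an = 1`, `ρ̄_{E,7}` onto (Cremona galrep: no code); lane residue cell `(7, X11b)` (bsdN v4u/v5u of record: `residue:X11b`);
ALSO the unit's GEN 10 beyond-window DATA record in `X11b/BeyondWindowRecords70.lean` (binders as displayed there)). Tamagawa-OBSTRUCTED, shape J1: the ONLY prime `q ∣ N` with `7 ∣ c_q` is `q = 5` (Kodaira `I7` split, `c_5 = 7`, `w = ord_7 c_5 = 1`) — engines A (Tate `tateY`) = B (PARI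
`elllocalred`, j269294) = C (observatory `TamLocal` ⟨5, 2, 1, 1, 0, 0, 0, 7, 0, 0, 7⟩, re-checked by the kernel below). Lane fields of record (`|D| ≤ 1511`): `-1511`: `m = 7056` (`ord = 2`).
DEEP FIELD `D = -2159` (17·127): **`m = [E(K):ℤy_K] = 10080`, `ord_7 m = 1 = w`** (`ρ = 25401600`; `L'(E,1) = 13.25982803`, `L(E^D,1) = 4.183075198`, `ĥ(x) = 4.104790458`; `N_{E^D} = 725341936410`)
— engine 1 (j268106) = engine 2 (j269294): `m = 10080` EQUAL, dev. ≤ 8.8e-14, checks true; twist `E^D` (j269294): `N_F = 725341936410`, `#tors·∏c·#Ш_an = 1·1008·100` — `ord_7 #Ш_an(E^D) = 0`, `ord_7 ∏c(E^D) = 1` — BSD-consistent. Jetchev MAX-form: `ord_7 #Ш(E/ℚ) ≤ 2(w − w) = 0 = ord_7 #Ш_an` ⇒ Miller's `BSD(E,7)` modulo the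
displayed binders (`hMJ` FLAGGED `Miller11-Thm54-Cha-case`, `JET@p|N`; `hGZK`; Heegner datum; `hv`; `hr`; `hs`). Kernel: `Δ ≠ 0`,
global minimality (support form, `bad = [(2, 1, 9), (3, 2, 49), (5, 1, 7), (7, 1, 2), (13, 1, 1), (19, 1, 3)]`), `7 ∣ Δ ∧ 7 ∤ c₄`, `E[7]` irreducible (`ℓ = 37`, `#Ẽ(𝔽_37) = 45`, `a_37 = -7`, `X² − a_ℓX + ℓ` root-free
mod `7`), `c_5(W/ℚ_5) = 7` (`TamLocal` ⟨5, 2, 1, 1, 0, 0, 0, 7, 0, 0, 7⟩). Per pair; LITERAL currency; nothing booked.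
[cite: Miller2011LMS, Thm. 5.4 (arXiv:1010.2431 p. 11) and Def. 1.1] [cite: Jetchev2008, Thm. 1.1] [cite: Mazur1978, §6 Prop. 6.3 (1) (p. 153)]
[cite: Silverman1994, IV.9.4] [cite: Cremona2006, Table 1 (label 155610bd1)] -/
theorem bsdp_j155610bd1_7 (hMJ : thm54_cha_padicValNat_shaOrder_add_tamagawa_le)
    (hGZK : rank_eq_analyticRank_of_analyticRank_le_one) (W : WeierstrassCurve ℚ)
    (hW : W = ⟨1, -1, 1, -2332289810372, 1405815555225018471⟩) {N : ℕ} [NeZero N] {K : Type} [Field K] [NumberField K]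
    (hK : IsImaginaryQuadratic K) (hH : SatisfiesHeegnerHypothesis N K) {P : (W.baseChange K).toAffine.Point}
    (hP : IsHeegnerPoint N W K P) (hnt : ¬ IsOfFinAddOrder P) (hpD : ¬ (7 : ℤ) ∣ NumberField.discr K)
    (hpN : ¬ 7 ^ 2 ∣ N) (hqN : 5 ∣ N) (hv : padicValNat 7 (AddSubgroup.zmultiples P).index ≤ 1)
    (hr : W.analyticRank ≤ 1) {s : ℚ} (hs : shaAn W = (s : ℂ)) (hvs : padicValRat 7 s = 0) : BSDp W 7 :=
  bsdp_prime_of_jetchevIndex_of_tamLocal_support 7 (by norm_num) (by norm_num) 1 (-1) 1 (-2332289810372) 1405815555225018471 (by decide +kernel)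
    [(2, 1, 9), (3, 2, 49), (5, 1, 7), (7, 1, 2), (13, 1, 1), (19, 1, 3)] (by decide +kernel) (by decide +kernel) (by decide +kernel)
    (by decide +kernel) (by decide +kernel) 37 (by norm_num) (by norm_num) (by norm_num)
    (by decide +kernel) (n := 45) (by decide +kernel) (by decide +kernel) 5 (by norm_num) (T := ⟨5, 2, 1, 1, 0, 0, 0, 7, 0, 0, 7⟩) rfl
    (by decide +kernel) (c := 7) (by decide +kernel) (w := 1) (by decide +kernel) hMJ hGZK W hW hK hH hP hnt (mod_cast hpD)
    hpN hqN hv hr hs hvs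

/-- **`BSD(E,7)` for `170170v1`** (`N = 170170 = 2·5·7·11·13·17`; NON-SPLIT MULTIPLICATIVE at `7` (Kodaira `I8`, `c_7 = 2`); `#tors = 1`, `∏c = 14`,
`r_an = 1`, `#Ш_an = 1`, `ρ̄_{E,7}` onto (Cremona galrep: no code); lane residue cell `(7, X11b)` (bsdN v4u/v5u of record: `residue:X11b`);
ALSO the unit's GEN 10 beyond-window DATA record in `X11b/BeyondWindowRecords19.lean` (binders as displayed there)). Tamagawa-OBSTRUCTED, shape J1: the ONLY prime `q ∣ N` with `7 ∣ c_q` is `q = 2` (Kodaira `I7` split, `c_2 = 7`, `w = ord_7 c_2 = 1`) — engines A (Tate `tateY`) = B (PARI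
`elllocalred`, j269294) = C (observatory `TamLocal` ⟨2, 1, 1, 0, 0, 0, 0, 7, 0, 0, 7⟩, re-checked by the kernel below). Lane fields of record (`|D| ≤ 1511`): `-831`: `m = 196` (`ord = 2`).
DEEP FIELD `D = -2551` (prime): **`m = [E(K):ℤy_K] = 84`, `ord_7 m = 1 = w`** (`ρ = 1764`; `L'(E,1) = 21.23268817`, `L(E^D,1) = 0.6767383897`, `ĥ(x) = 2.705441927`; `N_{E^D} = 1107398462170`)
— engine 1 (j268106) = engine 2 (j269294): `m = 84` EQUAL, dev. ≤ 4.5e-14, checks true; twist `E^D` (j269294): `N_F = 1107398462170`, `#tors·∏c·#Ш_an = 1·14·9` — `ord_7 #Ш_an(E^D) = 0`, `ord_7 ∏c(E^D) = 1` — BSD-consistent. Jetchev MAX-form: `ord_7 #Ш(E/ℚ) ≤ 2(w − w) = 0 = ord_7 #Ш_an` ⇒ Miller's `BSD(E,7)` modulo the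
displayed binders (`hMJ` FLAGGED `Miller11-Thm54-Cha-case`, `JET@p|N`; `hGZK`; Heegner datum; `hv`; `hr`; `hs`). Kernel: `Δ ≠ 0`,
global minimality (bounded Kraus criterion), `7 ∣ Δ ∧ 7 ∤ c₄`, `E[7]` irreducible (`ℓ = 29`, `#Ẽ(𝔽_29) = 30`, `a_29 = 0`, `X² − a_ℓX + ℓ` root-free
mod `7`), `c_2(W/ℚ_2) = 7` (`TamLocal` ⟨2, 1, 1, 0, 0, 0, 0, 7, 0, 0, 7⟩). Per pair; LITERAL currency; nothing booked.
[cite: Miller2011LMS, Thm. 5.4 (arXiv:1010.2431 p. 11) and Def. 1.1] [cite: Jetchev2008, Thm. 1.1] [cite: Mazur1978, §6 Prop. 6.3 (1) (p. 153)]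
[cite: Silverman1994, IV.9.4] [cite: Cremona2006, Table 1 (label 170170v1)] -/
theorem bsdp_j170170v1_7 (hMJ : thm54_cha_padicValNat_shaOrder_add_tamagawa_le)
    (hGZK : rank_eq_analyticRank_of_analyticRank_le_one) (W : WeierstrassCurve ℚ)
    (hW : W = ⟨1, -1, 1, -95988, 11447767⟩) {N : ℕ} [NeZero N] {K : Type} [Field K] [NumberField K]
    (hK : IsImaginaryQuadratic K) (hH : SatisfiesHeegnerHypothesis N K) {P : (W.baseChange K).toAffine.Point}
    (hP : IsHeegnerPoint N W K P) (hnt : ¬ IsOfFinAddOrder P) (hpD : ¬ (7 : ℤ) ∣ NumberField.discr K)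
    (hpN : ¬ 7 ^ 2 ∣ N) (hqN : 2 ∣ N) (hv : padicValNat 7 (AddSubgroup.zmultiples P).index ≤ 1)
    (hr : W.analyticRank ≤ 1) {s : ℚ} (hs : shaAn W = (s : ℂ)) (hvs : padicValRat 7 s = 0) : BSDp W 7 :=
  bsdp_prime_of_jetchevIndex_of_tamLocal 7 (by norm_num) (by norm_num) 1 (-1) 1 (-95988) 11447767 (by decide +kernel)
    (by decide +kernel) (by decide +kernel) (by decide +kernel) (by decide +kernel) 29 (by norm_num) (by norm_num) (by norm_num)
    (by decide +kernel) (n := 30) (by decide +kernel) (by decide +kernel) 2 (by norm_num) (T := ⟨2, 1, 1, 0, 0, 0, 0, 7, 0, 0, 7⟩) rfl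
    (by decide +kernel) (c := 7) (by decide +kernel) (w := 1) (by decide +kernel) hMJ hGZK W hW hK hH hP hnt (mod_cast hpD)
    hpN hqN hv hr hs hvs

/-- **`BSD(E,7)` for `270270y1`** (`N = 270270 = 2·3³·5·7·11·13`; SPLIT MULTIPLICATIVE at `7` (Kodaira `I1`, `c_7 = 1`); `#tors = 1`, `∏c = 28`,
`r_an = 1`, `#Ш_an = 1`, `ρ̄_{E,7}` onto (Cremona galrep: no code); lane residue cell `(7, X11b)` (bsdN v4u/v5u of record: `residue:X11b`);
ALSO the unit's GEN 10 beyond-window DATA record in `X11b/BeyondWindowRecords33.lean` (binders as displayed there)). Tamagawa-OBSTRUCTED, shape J1: the ONLY prime `q ∣ N` with `7 ∣ c_q` is `q = 5` (Kodaira `I7` split, `c_5 = 7`, `w = ord_7 c_5 = 1`) — engines A (Tate `tateY`) = B (PARI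
`elllocalred`, j269294) = C (observatory `TamLocal` ⟨5, 2, 1, 1, 0, 0, 0, 7, 0, 0, 7⟩, re-checked by the kernel below). Lane fields of record (`|D| ≤ 1511`): `-1559`: `m = 392` (`ord = 2`).
DEEP FIELD `D = -3071` (37·83): **`m = [E(K):ℤy_K] = 560`, `ord_7 m = 1 = w`** (`ρ = 78400`; `L'(E,1) = 5.532872737`, `L(E^D,1) = 5.416240843`, `ĥ(x) = 1.280664984`; `N_{E^D} = 2548927451070`)
— engine 1 (j268106) = engine 2 (j269294): `m = 560` EQUAL, dev. ≤ 4.0e-14, checks true; twist `E^D` (j269294): `N_F = 2548927451070`, `#tors·∏c·#Ш_an = 1·56·100` — `ord_7 #Ш_an(E^D) = 0`, `ord_7 ∏c(E^D) = 1` — BSD-consistent. Jetchev MAX-form: `ord_7 #Ш(E/ℚ) ≤ 2(w − w) = 0 = ord_7 #Ш_an` ⇒ Miller's `BSD(E,7)` modulo the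
displayed binders (`hMJ` FLAGGED `Miller11-Thm54-Cha-case`, `JET@p|N`; `hGZK`; Heegner datum; `hv`; `hr`; `hs`). Kernel: `Δ ≠ 0`,
global minimality (bounded Kraus criterion), `7 ∣ Δ ∧ 7 ∤ c₄`, `E[7]` irreducible (`ℓ = 19`, `#Ẽ(𝔽_19) = 18`, `a_19 = 2`, `X² − a_ℓX + ℓ` root-free
mod `7`), `c_5(W/ℚ_5) = 7` (`TamLocal` ⟨5, 2, 1, 1, 0, 0, 0, 7, 0, 0, 7⟩). Per pair; LITERAL currency; nothing booked.
[cite: Miller2011LMS, Thm. 5.4 (arXiv:1010.2431 p. 11) and Def. 1.1] [cite: Jetchev2008, Thm. 1.1] [cite: Mazur1978, §6 Prop. 6.3 (1) (p. 153)]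
[cite: Silverman1994, IV.9.4] [cite: Cremona2006, Table 1 (label 270270y1)] -/
theorem bsdp_j270270y1_7 (hMJ : thm54_cha_padicValNat_shaOrder_add_tamagawa_le)
    (hGZK : rank_eq_analyticRank_of_analyticRank_le_one) (W : WeierstrassCurve ℚ)
    (hW : W = ⟨1, -1, 0, -3822999, 3182827805⟩) {N : ℕ} [NeZero N] {K : Type} [Field K] [NumberField K]
    (hK : IsImaginaryQuadratic K) (hH : SatisfiesHeegnerHypothesis N K) {P : (W.baseChange K).toAffine.Point}
    (hP : IsHeegnerPoint N W K P) (hnt : ¬ IsOfFinAddOrder P) (hpD : ¬ (7 : ℤ) ∣ NumberField.discr K)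
    (hpN : ¬ 7 ^ 2 ∣ N) (hqN : 5 ∣ N) (hv : padicValNat 7 (AddSubgroup.zmultiples P).index ≤ 1)
    (hr : W.analyticRank ≤ 1) {s : ℚ} (hs : shaAn W = (s : ℂ)) (hvs : padicValRat 7 s = 0) : BSDp W 7 :=
  bsdp_prime_of_jetchevIndex_of_tamLocal 7 (by norm_num) (by norm_num) 1 (-1) 0 (-3822999) 3182827805 (by decide +kernel)
    (by decide +kernel) (by decide +kernel) (by decide +kernel) (by decide +kernel) 19 (by norm_num) (by norm_num) (by norm_num)
    (by decide +kernel) (n := 18) (by decide +kernel) (by decide +kernel) 5 (by norm_num) (T := ⟨5, 2, 1, 1, 0, 0, 0, 7, 0, 0, 7⟩) rfl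
    (by decide +kernel) (c := 7) (by decide +kernel) (w := 1) (by decide +kernel) hMJ hGZK W hW hK hH hP hnt (mod_cast hpD)
    hpN hqN hv hr hs hvs

/-- **`BSD(E,7)` for `303450fd1`** (`N = 303450 = 2·3·5²·7·17²`; SPLIT MULTIPLICATIVE at `7` (Kodaira `I1`, `c_7 = 1`); `#tors = 1`, `∏c = 14`,
`r_an = 1`, `#Ш_an = 1`, `ρ̄_{E,7}` onto (Cremona galrep: no code); lane residue cell `(7, X11b)` (bsdN v4u/v5u of record: `residue:X11b`);
ALSO the unit's GEN 10 beyond-window DATA record in `X11b/BeyondWindowRecords37.lean` (binders as displayed there)). Tamagawa-OBSTRUCTED, shape J1: the ONLY prime `q ∣ N` with `7 ∣ c_q` is `q = 2` (Kodaira `I7` split, `c_2 = 7`, `w = ord_7 c_2 = 1`) — engines A (Tate `tateY`) = B (PARI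
`elllocalred`, j269294) = C (observatory `TamLocal` ⟨2, 1, 1, 0, 0, 0, 0, 7, 0, 0, 7⟩, re-checked by the kernel below). Lane fields of record (`|D| ≤ 1511`): `-671`: `m = 196` (`ord = 2`).
DEEP FIELD `D = -1511` (prime): **`m = [E(K):ℤy_K] = 560`, `ord_7 m = 1 = w`** (`ρ = 78400`; `L'(E,1) = 11.90827283`, `L(E^D,1) = 6.712369647`, `ĥ(x) = 25.03048238`; `N_{E^D} = 692813067450`)
— engine 1 (j268106) = engine 2 (j269294): `m = 560` EQUAL, dev. ≤ 1.5e-14, checks true; twist `E^D` (j269294): `N_F = 692813067450`, `#tors·∏c·#Ш_an = 1·28·400` — `ord_7 #Ш_an(E^D) = 0`, `ord_7 ∏c(E^D) = 1` — BSD-consistent. Jetchev MAX-form: `ord_7 #Ш(E/ℚ) ≤ 2(w − w) = 0 = ord_7 #Ш_an` ⇒ Miller's `BSD(E,7)` modulo the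
displayed binders (`hMJ` FLAGGED `Miller11-Thm54-Cha-case`, `JET@p|N`; `hGZK`; Heegner datum; `hv`; `hr`; `hs`). Kernel: `Δ ≠ 0`,
global minimality (bounded Kraus criterion), `7 ∣ Δ ∧ 7 ∤ c₄`, `E[7]` irreducible (`ℓ = 11`, `#Ẽ(𝔽_11) = 11`, `a_11 = 1`, `X² − a_ℓX + ℓ` root-free
mod `7`), `c_2(W/ℚ_2) = 7` (`TamLocal` ⟨2, 1, 1, 0, 0, 0, 0, 7, 0, 0, 7⟩). Per pair; LITERAL currency; nothing booked.
[cite: Miller2011LMS, Thm. 5.4 (arXiv:1010.2431 p. 11) and Def. 1.1] [cite: Jetchev2008, Thm. 1.1] [cite: Mazur1978, §6 Prop. 6.3 (1) (p. 153)]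
[cite: Silverman1994, IV.9.4] [cite: Cremona2006, Table 1 (label 303450fd1)] -/
theorem bsdp_j303450fd1_7 (hMJ : thm54_cha_padicValNat_shaOrder_add_tamagawa_le)
    (hGZK : rank_eq_analyticRank_of_analyticRank_le_one) (W : WeierstrassCurve ℚ)
    (hW : W = ⟨1, 1, 1, 136230837, 2022964540281⟩) {N : ℕ} [NeZero N] {K : Type} [Field K] [NumberField K]
    (hK : IsImaginaryQuadratic K) (hH : SatisfiesHeegnerHypothesis N K) {P : (W.baseChange K).toAffine.Point}
    (hP : IsHeegnerPoint N W K P) (hnt : ¬ IsOfFinAddOrder P) (hpD : ¬ (7 : ℤ) ∣ NumberField.discr K)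
    (hpN : ¬ 7 ^ 2 ∣ N) (hqN : 2 ∣ N) (hv : padicValNat 7 (AddSubgroup.zmultiples P).index ≤ 1)
    (hr : W.analyticRank ≤ 1) {s : ℚ} (hs : shaAn W = (s : ℂ)) (hvs : padicValRat 7 s = 0) : BSDp W 7 :=
  bsdp_prime_of_jetchevIndex_of_tamLocal 7 (by norm_num) (by norm_num) 1 1 1 136230837 2022964540281 (by decide +kernel)
    (by decide +kernel) (by decide +kernel) (by decide +kernel) (by decide +kernel) 11 (by norm_num) (by norm_num) (by norm_num)
    (by decide +kernel) (n := 11) (by decide +kernel) (by decide +kernel) 2 (by norm_num) (T := ⟨2, 1, 1, 0, 0, 0, 0, 7, 0, 0, 7⟩) rfl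
    (by decide +kernel) (c := 7) (by decide +kernel) (w := 1) (by decide +kernel) hMJ hGZK W hW hK hH hP hnt (mod_cast hpD)
    hpN hqN hv hr hs hvs

/-- **`BSD(E,7)` for `306306ch1`** (`N = 306306 = 2·3²·7·11·13·17`; SPLIT MULTIPLICATIVE at `7` (Kodaira `I1`, `c_7 = 1`); `#tors = 1`, `∏c = 14`,
`r_an = 1`, `#Ш_an = 1`, `ρ̄_{E,7}` onto (Cremona galrep: no code); lane residue cell `(7, X11b)` (bsdN v4u/v5u of record: `residue:X11b`);
ALSO the unit's GEN 10 beyond-window DATA record in `X11b/BeyondWindowRecords38.lean` (binders as displayed there)). Tamagawa-OBSTRUCTED, shape J1: the ONLY prime `q ∣ N` with `7 ∣ c_q` is `q = 2` (Kodaira `I7` split, `c_2 = 7`, `w = ord_7 c_2 = 1`) — engines A (Tate `tateY`) = B (PARI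
`elllocalred`, j269294) = C (observatory `TamLocal` ⟨2, 1, 1, 0, 0, 0, 0, 7, 0, 0, 7⟩, re-checked by the kernel below). Lane fields of record (`|D| ≤ 1511`): `-1223`: `m = 196` (`ord = 2`).
DEEP FIELD `D = -2903` (prime): **`m = [E(K):ℤy_K] = 112`, `ord_7 m = 1 = w`** (`ρ = 3136`; `L'(E,1) = 10.63726781`, `L(E^D,1) = 2.403593674`, `ĥ(x) = 0.6623943123`; `N_{E^D} = 2581365941154`)
— engine 1 (j268106) = engine 2 (j269294): `m = 112` EQUAL, dev. ≤ 1.4e-13, checks true; twist `E^D` (j269294): `N_F = 2581365941154`, `#tors·∏c·#Ш_an = 1·28·16` — `ord_7 #Ш_an(E^D) = 0`, `ord_7 ∏c(E^D) = 1` — BSD-consistent. Jetchev MAX-form: `ord_7 #Ш(E/ℚ) ≤ 2(w − w) = 0 = ord_7 #Ш_an` ⇒ Miller's `BSD(E,7)` modulo the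
displayed binders (`hMJ` FLAGGED `Miller11-Thm54-Cha-case`, `JET@p|N`; `hGZK`; Heegner datum; `hv`; `hr`; `hs`). Kernel: `Δ ≠ 0`,
global minimality (bounded Kraus criterion), `7 ∣ Δ ∧ 7 ∤ c₄`, `E[7]` irreducible (`ℓ = 5`, `#Ẽ(𝔽_5) = 8`, `a_5 = -2`, `X² − a_ℓX + ℓ` root-free
mod `7`), `c_2(W/ℚ_2) = 7` (`TamLocal` ⟨2, 1, 1, 0, 0, 0, 0, 7, 0, 0, 7⟩). Per pair; LITERAL currency; nothing booked.
[cite: Miller2011LMS, Thm. 5.4 (arXiv:1010.2431 p. 11) and Def. 1.1] [cite: Jetchev2008, Thm. 1.1] [cite: Mazur1978, §6 Prop. 6.3 (1) (p. 153)]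
[cite: Silverman1994, IV.9.4] [cite: Cremona2006, Table 1 (label 306306ch1)] -/
theorem bsdp_j306306ch1_7 (hMJ : thm54_cha_padicValNat_shaOrder_add_tamagawa_le)
    (hGZK : rank_eq_analyticRank_of_analyticRank_le_one) (W : WeierstrassCurve ℚ)
    (hW : W = ⟨1, -1, 1, -4646, 123445⟩) {N : ℕ} [NeZero N] {K : Type} [Field K] [NumberField K]
    (hK : IsImaginaryQuadratic K) (hH : SatisfiesHeegnerHypothesis N K) {P : (W.baseChange K).toAffine.Point}
    (hP : IsHeegnerPoint N W K P) (hnt : ¬ IsOfFinAddOrder P) (hpD : ¬ (7 : ℤ) ∣ NumberField.discr K)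
    (hpN : ¬ 7 ^ 2 ∣ N) (hqN : 2 ∣ N) (hv : padicValNat 7 (AddSubgroup.zmultiples P).index ≤ 1)
    (hr : W.analyticRank ≤ 1) {s : ℚ} (hs : shaAn W = (s : ℂ)) (hvs : padicValRat 7 s = 0) : BSDp W 7 :=
  bsdp_prime_of_jetchevIndex_of_tamLocal 7 (by norm_num) (by norm_num) 1 (-1) 1 (-4646) 123445 (by decide +kernel)
    (by decide +kernel) (by decide +kernel) (by decide +kernel) (by decide +kernel) 5 (by norm_num) (by norm_num) (by norm_num)
    (by decide +kernel) (n := 8) (by decide +kernel) (by decide +kernel) 2 (by norm_num) (T := ⟨2, 1, 1, 0, 0, 0, 0, 7, 0, 0, 7⟩) rfl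
    (by decide +kernel) (c := 7) (by decide +kernel) (w := 1) (by decide +kernel) hMJ hGZK W hW hK hH hP hnt (mod_cast hpD)
    hpN hqN hv hr hs hvs

/-- **`BSD(E,7)` for `312018by1`** (`N = 312018 = 2·3·7·17·19·23`; SPLIT MULTIPLICATIVE at `7` (Kodaira `I5`, `c_7 = 5`); `#tors = 1`, `∏c = 70`,
`r_an = 1`, `#Ш_an = 1`, `ρ̄_{E,7}` onto (Cremona galrep: no code); lane residue cell `(7, X11b)` (bsdN v4u/v5u of record: `residue:X11b`);
ALSO the unit's GEN 10 beyond-window DATA record in `X11b/BeyondWindowRecords38.lean` (binders as displayed there)). Tamagawa-OBSTRUCTED, shape J1: the ONLY prime `q ∣ N` with `7 ∣ c_q` is `q = 2` (Kodaira `I7` split, `c_2 = 7`, `w = ord_7 c_2 = 1`) — engines A (Tate `tateY`) = B (PARI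
`elllocalred`, j269294) = C (observatory `TamLocal` ⟨2, 1, 1, 0, 0, 0, 0, 7, 0, 0, 7⟩, re-checked by the kernel below). Lane fields of record (`|D| ≤ 1511`): `-383`: `m = 980` (`ord = 2`); `-1055`: `m = 980` (`ord = 2`).
DEEP FIELD `D = -2735` (5·547): **`m = [E(K):ℤy_K] = 700`, `ord_7 m = 1 = w`** (`ρ = 122500`; `L'(E,1) = 11.77105738`, `L(E^D,1) = 4.79997768`, `ĥ(x) = 0.3300705466`; `N_{E^D} = 2333964844050`)
— engine 1 (j268106) = engine 2 (j269294): `m = 700` EQUAL, dev. ≤ 8.1e-15, checks true; twist `E^D` (j269294): `N_F = 2333964844050`, `#tors·∏c·#Ш_an = 1·70·25` — `ord_7 #Ш_an(E^D) = 0`, `ord_7 ∏c(E^D) = 1` — BSD-consistent. Jetchev MAX-form: `ord_7 #Ш(E/ℚ) ≤ 2(w − w) = 0 = ord_7 #Ш_an` ⇒ Miller's `BSD(E,7)` modulo the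
displayed binders (`hMJ` FLAGGED `Miller11-Thm54-Cha-case`, `JET@p|N`; `hGZK`; Heegner datum; `hv`; `hr`; `hs`). Kernel: `Δ ≠ 0`,
global minimality (bounded Kraus criterion), `7 ∣ Δ ∧ 7 ∤ c₄`, `E[7]` irreducible (`ℓ = 5`, `#Ẽ(𝔽_5) = 9`, `a_5 = -3`, `X² − a_ℓX + ℓ` root-free
mod `7`), `c_2(W/ℚ_2) = 7` (`TamLocal` ⟨2, 1, 1, 0, 0, 0, 0, 7, 0, 0, 7⟩). Per pair; LITERAL currency; nothing booked.
[cite: Miller2011LMS, Thm. 5.4 (arXiv:1010.2431 p. 11) and Def. 1.1] [cite: Jetchev2008, Thm. 1.1] [cite: Mazur1978, §6 Prop. 6.3 (1) (p. 153)]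
[cite: Silverman1994, IV.9.4] [cite: Cremona2006, Table 1 (label 312018by1)] -/
theorem bsdp_j312018by1_7 (hMJ : thm54_cha_padicValNat_shaOrder_add_tamagawa_le)
    (hGZK : rank_eq_analyticRank_of_analyticRank_le_one) (W : WeierstrassCurve ℚ)
    (hW : W = ⟨1, 0, 0, -1227097, 523096121⟩) {N : ℕ} [NeZero N] {K : Type} [Field K] [NumberField K]
    (hK : IsImaginaryQuadratic K) (hH : SatisfiesHeegnerHypothesis N K) {P : (W.baseChange K).toAffine.Point}
    (hP : IsHeegnerPoint N W K P) (hnt : ¬ IsOfFinAddOrder P) (hpD : ¬ (7 : ℤ) ∣ NumberField.discr K)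
    (hpN : ¬ 7 ^ 2 ∣ N) (hqN : 2 ∣ N) (hv : padicValNat 7 (AddSubgroup.zmultiples P).index ≤ 1)
    (hr : W.analyticRank ≤ 1) {s : ℚ} (hs : shaAn W = (s : ℂ)) (hvs : padicValRat 7 s = 0) : BSDp W 7 :=
  bsdp_prime_of_jetchevIndex_of_tamLocal 7 (by norm_num) (by norm_num) 1 0 0 (-1227097) 523096121 (by decide +kernel)
    (by decide +kernel) (by decide +kernel) (by decide +kernel) (by decide +kernel) 5 (by norm_num) (by norm_num) (by norm_num)
    (by decide +kernel) (n := 9) (by decide +kernel) (by decide +kernel) 2 (by norm_num) (T := ⟨2, 1, 1, 0, 0, 0, 0, 7, 0, 0, 7⟩) rfl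
    (by decide +kernel) (c := 7) (by decide +kernel) (w := 1) (by decide +kernel) hMJ hGZK W hW hK hH hP hnt (mod_cast hpD)
    hpN hqN hv hr hs hvs

/-- **`BSD(E,7)` for `395010co1`** (`N = 395010 = 2·3³·5·7·11·19`; NON-SPLIT MULTIPLICATIVE at `7` (Kodaira `I5`, `c_7 = 1`); `#tors = 1`, `∏c = 7`,
`r_an = 1`, `#Ш_an = 1`, `ρ̄_{E,7}` onto (Cremona galrep: no code); lane residue cell `(7, X11b)` (bsdN v4u/v5u of record: `residue:X11b`);
ALSO the unit's GEN 10 beyond-window DATA record in `X11b/BeyondWindowRecords52.lean` (binders as displayed there)). Tamagawa-OBSTRUCTED, shape J1: the ONLY prime `q ∣ N` with `7 ∣ c_q` is `q = 5` (Kodaira `I7` split, `c_5 = 7`, `w = ord_7 c_5 = 1`) — engines A (Tate `tateY`) = B (PARI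
`elllocalred`, j269294) = C (observatory `TamLocal` ⟨5, 2, 1, 1, 0, 0, 0, 7, 0, 0, 7⟩, re-checked by the kernel below). Lane fields of record (`|D| ≤ 1511`): `-1319`: `m = 98` (`ord = 2`).
DEEP FIELD `D = -2351` (prime): **`m = [E(K):ℤy_K] = 70`, `ord_7 m = 1 = w`** (`ρ = 1225`; `L'(E,1) = 15.09056258`, `L(E^D,1) = 2.577604631`, `ĥ(x) = 13.10349017`; `N_{E^D} = 2183299667010`)
— engine 1 (j268106) = engine 2 (j269294): `m = 70` EQUAL, dev. ≤ 7.3e-14, checks true; twist `E^D` (j269294): `N_F = 2183299667010`, `#tors·∏c·#Ш_an = 1·14·25` — `ord_7 #Ш_an(E^D) = 0`, `ord_7 ∏c(E^D) = 1` — BSD-consistent. Jetchev MAX-form: `ord_7 #Ш(E/ℚ) ≤ 2(w − w) = 0 = ord_7 #Ш_an` ⇒ Miller's `BSD(E,7)` modulo the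
displayed binders (`hMJ` FLAGGED `Miller11-Thm54-Cha-case`, `JET@p|N`; `hGZK`; Heegner datum; `hv`; `hr`; `hs`). Kernel: `Δ ≠ 0`,
global minimality (bounded Kraus criterion), `7 ∣ Δ ∧ 7 ∤ c₄`, `E[7]` irreducible (`ℓ = 13`, `#Ẽ(𝔽_13) = 10`, `a_13 = 4`, `X² − a_ℓX + ℓ` root-free
mod `7`), `c_5(W/ℚ_5) = 7` (`TamLocal` ⟨5, 2, 1, 1, 0, 0, 0, 7, 0, 0, 7⟩). Per pair; LITERAL currency; nothing booked.
[cite: Miller2011LMS, Thm. 5.4 (arXiv:1010.2431 p. 11) and Def. 1.1] [cite: Jetchev2008, Thm. 1.1] [cite: Mazur1978, §6 Prop. 6.3 (1) (p. 153)]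
[cite: Silverman1994, IV.9.4] [cite: Cremona2006, Table 1 (label 395010co1)] -/
theorem bsdp_j395010co1_7 (hMJ : thm54_cha_padicValNat_shaOrder_add_tamagawa_le)
    (hGZK : rank_eq_analyticRank_of_analyticRank_le_one) (W : WeierstrassCurve ℚ)
    (hW : W = ⟨1, -1, 1, -32807, -5490719⟩) {N : ℕ} [NeZero N] {K : Type} [Field K] [NumberField K]
    (hK : IsImaginaryQuadratic K) (hH : SatisfiesHeegnerHypothesis N K) {P : (W.baseChange K).toAffine.Point}
    (hP : IsHeegnerPoint N W K P) (hnt : ¬ IsOfFinAddOrder P) (hpD : ¬ (7 : ℤ) ∣ NumberField.discr K)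
    (hpN : ¬ 7 ^ 2 ∣ N) (hqN : 5 ∣ N) (hv : padicValNat 7 (AddSubgroup.zmultiples P).index ≤ 1)
    (hr : W.analyticRank ≤ 1) {s : ℚ} (hs : shaAn W = (s : ℂ)) (hvs : padicValRat 7 s = 0) : BSDp W 7 :=
  bsdp_prime_of_jetchevIndex_of_tamLocal 7 (by norm_num) (by norm_num) 1 (-1) 1 (-32807) (-5490719) (by decide +kernel)
    (by decide +kernel) (by decide +kernel) (by decide +kernel) (by decide +kernel) 13 (by norm_num) (by norm_num) (by norm_num)
    (by decide +kernel) (n := 10) (by decide +kernel) (by decide +kernel) 5 (by norm_num) (T := ⟨5, 2, 1, 1, 0, 0, 0, 7, 0, 0, 7⟩) rfl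
    (by decide +kernel) (c := 7) (by decide +kernel) (w := 1) (by decide +kernel) hMJ hGZK W hW hK hH hP hnt (mod_cast hpD)
    hpN hqN hv hr hs hvs

/-- **`BSD(E,7)` for `408870cx1`** (`N = 408870 = 2·3²·5·7·11·59`; NON-SPLIT MULTIPLICATIVE at `7` (Kodaira `I5`, `c_7 = 1`); `#tors = 1`, `∏c = 28`,
`r_an = 1`, `#Ш_an = 1`, `ρ̄_{E,7}` onto (Cremona galrep: no code); lane residue cell `(7, X11b)` (bsdN v4u/v5u of record: `residue:X11b`);
ALSO the unit's GEN 10 beyond-window DATA record in `X11b/BeyondWindowRecords54.lean` (binders as displayed there)). Tamagawa-OBSTRUCTED, shape J1: the ONLY prime `q ∣ N` with `7 ∣ c_q` is `q = 11` (Kodaira `I7` split, `c_11 = 7`, `w = ord_7 c_11 = 1`) — engines A (Tate `tateY`) = B (PARI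
`elllocalred`, j269294) = C (observatory `TamLocal` ⟨11, 3, 1, 7, 0, 0, 0, 7, 0, 0, 7⟩, re-checked by the kernel below). Lane fields of record (`|D| ≤ 1511`): `-1151`: `m = 784` (`ord = 2`).
DEEP FIELD `D = -2351` (prime): **`m = [E(K):ℤy_K] = 280`, `ord_7 m = 1 = w`** (`ρ = 19600`; `L'(E,1) = 9.637491708`, `L(E^D,1) = 0.8829159924`, `ĥ(x) = 2.170357646`; `N_{E^D} = 2259906672870`)
— engine 1 (j268106) = engine 2 (j269294): `m = 280` EQUAL, dev. ≤ 5.3e-14, checks true; twist `E^D` (j269294): `N_F = 2259906672870`, `#tors·∏c·#Ш_an = 1·56·25` — `ord_7 #Ш_an(E^D) = 0`, `ord_7 ∏c(E^D) = 1` — BSD-consistent. Jetchev MAX-form: `ord_7 #Ш(E/ℚ) ≤ 2(w − w) = 0 = ord_7 #Ш_an` ⇒ Miller's `BSD(E,7)` modulo the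
displayed binders (`hMJ` FLAGGED `Miller11-Thm54-Cha-case`, `JET@p|N`; `hGZK`; Heegner datum; `hv`; `hr`; `hs`). Kernel: `Δ ≠ 0`,
global minimality (bounded Kraus criterion), `7 ∣ Δ ∧ 7 ∤ c₄`, `E[7]` irreducible (`ℓ = 13`, `#Ẽ(𝔽_13) = 13`, `a_13 = 1`, `X² − a_ℓX + ℓ` root-free
mod `7`), `c_11(W/ℚ_11) = 7` (`TamLocal` ⟨11, 3, 1, 7, 0, 0, 0, 7, 0, 0, 7⟩). Per pair; LITERAL currency; nothing booked.
[cite: Miller2011LMS, Thm. 5.4 (arXiv:1010.2431 p. 11) and Def. 1.1] [cite: Jetchev2008, Thm. 1.1] [cite: Mazur1978, §6 Prop. 6.3 (1) (p. 153)]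
[cite: Silverman1994, IV.9.4] [cite: Cremona2006, Table 1 (label 408870cx1)] -/
theorem bsdp_j408870cx1_7 (hMJ : thm54_cha_padicValNat_shaOrder_add_tamagawa_le)
    (hGZK : rank_eq_analyticRank_of_analyticRank_le_one) (W : WeierstrassCurve ℚ)
    (hW : W = ⟨1, -1, 1, -37136318, 87121260231⟩) {N : ℕ} [NeZero N] {K : Type} [Field K] [NumberField K]
    (hK : IsImaginaryQuadratic K) (hH : SatisfiesHeegnerHypothesis N K) {P : (W.baseChange K).toAffine.Point}
    (hP : IsHeegnerPoint N W K P) (hnt : ¬ IsOfFinAddOrder P) (hpD : ¬ (7 : ℤ) ∣ NumberField.discr K)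
    (hpN : ¬ 7 ^ 2 ∣ N) (hqN : 11 ∣ N) (hv : padicValNat 7 (AddSubgroup.zmultiples P).index ≤ 1)
    (hr : W.analyticRank ≤ 1) {s : ℚ} (hs : shaAn W = (s : ℂ)) (hvs : padicValRat 7 s = 0) : BSDp W 7 :=
  bsdp_prime_of_jetchevIndex_of_tamLocal 7 (by norm_num) (by norm_num) 1 (-1) 1 (-37136318) 87121260231 (by decide +kernel)
    (by decide +kernel) (by decide +kernel) (by decide +kernel) (by decide +kernel) 13 (by norm_num) (by norm_num) (by norm_num)
    (by decide +kernel) (n := 13) (by decide +kernel) (by decide +kernel) 11 (by norm_num) (T := ⟨11, 3, 1, 7, 0, 0, 0, 7, 0, 0, 7⟩) rfl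
    (by decide +kernel) (c := 7) (by decide +kernel) (w := 1) (by decide +kernel) hMJ hGZK W hW hK hH hP hnt (mod_cast hpD)
    hpN hqN hv hr hs hvs

/-- **`BSD(E,7)` for `428400bx1`** (`N = 428400 = 2⁴·3²·5²·7·17`; NON-SPLIT MULTIPLICATIVE at `7` (Kodaira `I5`, `c_7 = 1`); `#tors = 1`, `∏c = 14`,
`r_an = 1`, `#Ш_an = 1`, `ρ̄_{E,7}` onto (Cremona galrep: no code); lane residue cell `(7, X11b)` (bsdN v4u/v5u of record: `residue:X11b`);
ALSO the unit's GEN 10 beyond-window DATA record in `X11b/BeyondWindowSurjRecords03.lean` (binders as displayed there)). Tamagawa-OBSTRUCTED, shape J1: the ONLY prime `q ∣ N` with `7 ∣ c_q` is `q = 17` (Kodaira `I7` split, `c_17 = 7`, `w = ord_7 c_17 = 1`) — engines A (Tate `tateY`) = B (PARI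
`elllocalred`, j269294) = C (observatory `TamLocal` ⟨17, 4, 1, 2, 0, 0, 0, 7, 0, 0, 7⟩, re-checked by the kernel below). Lane fields of record (`|D| ≤ 1511`): `-671`: `m = 196` (`ord = 2`).
DEEP FIELD `D = -1511` (prime): **`m = [E(K):ℤy_K] = 224`, `ord_7 m = 1 = w`** (`ρ = 12544`; `L'(E,1) = 6.403665513`, `L(E^D,1) = 0.9910994047`, `ĥ(x) = 18.82579666`; `N_{E^D} = 978089036400`)
— engine 1 (j268106) = engine 2 (j269294): `m = 224` EQUAL, dev. ≤ 6.6e-14, checks true; twist `E^D` (j269294): `N_F = 978089036400`, `#tors·∏c·#Ш_an = 1·56·16` — `ord_7 #Ш_an(E^D) = 0`, `ord_7 ∏c(E^D) = 1` — BSD-consistent. Jetchev MAX-form: `ord_7 #Ш(E/ℚ) ≤ 2(w − w) = 0 = ord_7 #Ш_an` ⇒ Miller's `BSD(E,7)` modulo the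
displayed binders (`hMJ` FLAGGED `Miller11-Thm54-Cha-case`, `JET@p|N`; `hGZK`; Heegner datum; `hv`; `hr`; `hs`). Kernel: `Δ ≠ 0`,
global minimality (bounded Kraus criterion), `7 ∣ Δ ∧ 7 ∤ c₄`, `E[7]` irreducible (`ℓ = 19`, `#Ẽ(𝔽_19) = 24`, `a_19 = -4`, `X² − a_ℓX + ℓ` root-free
mod `7`), `c_17(W/ℚ_17) = 7` (`TamLocal` ⟨17, 4, 1, 2, 0, 0, 0, 7, 0, 0, 7⟩). Per pair; LITERAL currency; nothing booked.
[cite: Miller2011LMS, Thm. 5.4 (arXiv:1010.2431 p. 11) and Def. 1.1] [cite: Jetchev2008, Thm. 1.1] [cite: Mazur1978, §6 Prop. 6.3 (1) (p. 153)]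
[cite: Silverman1994, IV.9.4] [cite: Cremona2006, Table 1 (label 428400bx1)] -/
theorem bsdp_j428400bx1_7 (hMJ : thm54_cha_padicValNat_shaOrder_add_tamagawa_le)
    (hGZK : rank_eq_analyticRank_of_analyticRank_le_one) (W : WeierstrassCurve ℚ)
    (hW : W = ⟨0, 0, 0, -1496070000, -21988890450000⟩) {N : ℕ} [NeZero N] {K : Type} [Field K] [NumberField K]
    (hK : IsImaginaryQuadratic K) (hH : SatisfiesHeegnerHypothesis N K) {P : (W.baseChange K).toAffine.Point}
    (hP : IsHeegnerPoint N W K P) (hnt : ¬ IsOfFinAddOrder P) (hpD : ¬ (7 : ℤ) ∣ NumberField.discr K)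
    (hpN : ¬ 7 ^ 2 ∣ N) (hqN : 17 ∣ N) (hv : padicValNat 7 (AddSubgroup.zmultiples P).index ≤ 1)
    (hr : W.analyticRank ≤ 1) {s : ℚ} (hs : shaAn W = (s : ℂ)) (hvs : padicValRat 7 s = 0) : BSDp W 7 :=
  bsdp_prime_of_jetchevIndex_of_tamLocal 7 (by norm_num) (by norm_num) 0 0 0 (-1496070000) (-21988890450000) (by decide +kernel)
    (by decide +kernel) (by decide +kernel) (by decide +kernel) (by decide +kernel) 19 (by norm_num) (by norm_num) (by norm_num)
    (by decide +kernel) (n := 24) (by decide +kernel) (by decide +kernel) 17 (by norm_num) (T := ⟨17, 4, 1, 2, 0, 0, 0, 7, 0, 0, 7⟩) rfl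
    (by decide +kernel) (c := 7) (by decide +kernel) (w := 1) (by decide +kernel) hMJ hGZK W hW hK hH hP hnt (mod_cast hpD)
    hpN hqN hv hr hs hvs

end Summit.BirchSwinnertonDyer.Rank1Residual.X11b

end
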